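import Mathlib

set_option linter.dupNamespace false

/-!
# B3♭ — theta killability, the A-isolation law and the Chern-slack law (letter model), monad-4 g25

Typed *specification / arithmetic* file for the cell `hsemireg-monad-4`, generation g25
(unit `hsemireg-monad-4-g25`, crux item `stmt-HodgeConjecture-18881`, decl `BlochSeedDiscOne`).

**Status sentence.** Nothing in this file is proved toward HC / HC_CM / HC_AV / №4 / 26512 /
18881 / H2.  It records, kernel-checked, the finite combinatorics and the ring arithmetic behind
three maps-free necessary conditions for a 3-term display `0 → A → N → C → 0`, `E = ker q / im i`
locally free of the designed rank, on letter DESIGNS over `X = (E_i × E_i)^4`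
(memo `B3FLAT-THETAKILL-CS-monad4-g25.md`).  Designs ≠ displays ≠ monads ≠ sheaves ≠ a SEED.

## Dictionary (letters of monad-4 g22–g24)

A letter `[a,x,y]` is the class `a·A_f + x·X_f + y·Y_f` on a factor `S_f = E_i × E_i`
(`A = Θ = E×0 + 0×E`, `A² = 2`, `X² = Y² = −2`, mixed products `0`); `n[a,x,y] = a² − x² − y²`
(`= χ = h⁰` for ample letters).  The 2-level alphabet of record is
`14I = [14,0,0]`, `15I = [15,0,0]`, `R_ζ = 12I + ℓ_ζ = [13,±1,0], [13,0,±1]`.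
A factor step `λ → λ'` of a block of `i` or `q` is a section of `O(λ' − λ) ⊗ P`, `P ∈ Pic⁰`.

* **Theta killability (model correction to g24).**  A step is *killable* when its class `δ` has
  `h⁰ = 1` for the labels that make it live: `δ` primitive null (`n = 0`, zero locus an elliptic
  fibre) **or** `δ` principal, `n(δ) = 1` (zero locus a translate of `Θ`; `h⁰(O(Θ) ⊗ P) = 1` for
  every `P`).  On the alphabet: `R_ζ → 14I` (null) and `14I → 15I` (theta, NEW) are killable,
  `R_ζ → 15I` (`n = 3`) is not (`killable_table`).  Under a letter-level labelling all blocks with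
  the same killed step in factor `f` are multiples of one section, so they vanish on one divisor;
  two killed steps of distinct classes in one factor meet (`gram_table`: `Θ·ℓ = 2`, `ℓ·ℓ' ∈ {2,4}`).
* **A-isolation law** (`targets_use_killable_step`).  The live non-killable steps are the identity
  and `R_ζ → 15I`; both preserve the letter `14I`.  Hence every live target `y ≠ x` of a cell `x`
  with a different number of `14I`-letters uses a killable step in some factor, and the product
  point «theta-translate at the `14I`-positions of `x`, the fibre of `ℓ_ζ` at its `R_ζ`-positions»
  kills the whole column of `i` through any A-copy of `x`.  On the design of record `2f9bdad8`
  (N = even #14I, P ∋ only odd #14I and `15I⁴`) this forces `A = 0`, `C = P`, and then `q` cannot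
  be onto at the generic point (`c(14I,R,R,R) = 56 > 28 ≥ m(sources)`): the design carries no
  display under any letter-level labelling (engines `orientlp_theta.py` INFEASIBLE, Farkas
  `yᵀb = −53038`; `isolaw.py` ×2).  g24's SURVIVES-EXHAUSTIVE used null steps only.
* **Chern-slack law (CS, labelling-free).**  For `U ⊆ N`-cells, `A' ⊆ A_{⊆U}`, `C' ⊆ C_{⊆U}` the
  restricted complex `A' → U → C'` is a monad, so `V = [U] − [A'] − [C']` has rank `s ≥ 0` and
  `c_j(V) = 0` for `j > s`.  Co-atom row: `U = {15I⁴}` (`m = 1914`), `A' =` the A-copies of the four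
  cells `14I_p·15I³` (`a_p = 478`): after the twist by `O(−15h)`, `c(V) = ∏_p (1 − A_p)^{−a_p}
  = ∏_p (1 + a_p A_p + a_p(a_p+1) pt_p)` (`coatom_factor_identity`, in the truncated factor ring
  `ℤ⟨1, A, pt⟩`, `A² = 2pt`, `A·pt = pt² = 0`), so `c₃(V)·H⁵ = 960·e₃(a) + 240·Σ_{p≠q} a_p(a_p+1)a_q
  = 734 585 199 360 ≠ 0` while `s = 1914 − 1912 = 2 < 3` (`coatom_violation_1d7e39cf`).
-/

namespace Summit.HodgeConjecture.HodgeConjecture.Cruxes.BlochSeedDiscOne.ThetaKill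

/-! ## Letters, `n`, the intersection pairing, killability -/

/-- A letter `[a,x,y] = a·A + x·X + y·Y` on one factor `E_i × E_i`. -/
abbrev Letter := ℤ × ℤ × ℤ

/-- `n[a,x,y] = a² − x² − y²` (`= χ`, and `= h⁰` for ample letters). -/
def Letter.n (l : Letter) : ℤ := l.1 * l.1 - l.2.1 * l.2.1 - l.2.2 * l.2.2

/-- Intersection pairing of two classes: `[a,x,y]·[a',x',y'] = 2(aa' − xx' − yy')`. -/
def Letter.dot (l l' : Letter) : ℤ := 2 * (l.1 * l'.1 - l.2.1 * l'.2.1 - l.2.2 * l'.2.2)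

/-- Difference class of a step `λ → λ'`. -/
def Letter.diff (l l' : Letter) : Letter := (l'.1 - l.1, l'.2.1 - l.2.1, l'.2.2 - l.2.2)

/-- Primitive null class (`a > 0`, `a² = x² + y²`, `gcd = 1`): zero locus an elliptic fibre, `h⁰ = 1`
for the aligned label.  (Bool-valued: no instances in this file.) -/
def Letter.isNullPrim (d : Letter) : Bool :=
  decide (0 < d.1) && decide (d.1 * d.1 = d.2.1 * d.2.1 + d.2.2 * d.2.2) && decide (Int.gcd d.1 (Int.gcd d.2.1 d.2.2) = 1)

/-- Principal class (`a > 0`, `n = 1`): zero locus a translate of `Θ`, `h⁰ = 1` for EVERY label. -/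
def Letter.isTheta (d : Letter) : Bool := decide (0 < d.1) && decide (d.n = 1)

/-- Killable step class = `h⁰ = 1`: primitive null or principal (the g25 model correction adds the
second disjunct; g24's engines used the first only). -/
def Letter.killable (d : Letter) : Bool := d.isNullPrim || d.isTheta

/-! ## The 2-level alphabet of record -/

def L14 : Letter := (14, 0, 0)
def L15 : Letter := (15, 0, 0)
def R1 : Letter := (13, 1, 0)
def Rm : Letter := (13, -1, 0)
def Ri : Letter := (13, 0, 1)
def Rj : Letter := (13, 0, -1)

/-- The four rays. -/
def rays : List Letter := [R1, Rm, Ri, Rj]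

/-- Killability table on the alphabet: `14I → 15I` is killable (theta, `n = 1`), every `R_ζ → 14I`
is killable (primitive null), no `R_ζ → 15I` is (`n = 3`, `h⁰ = 3`). -/
theorem killable_table :
    (Letter.diff L14 L15).isTheta = true ∧ (Letter.diff L14 L15).killable = true ∧
    (∀ r ∈ rays, (Letter.diff r L14).isNullPrim = true ∧ (Letter.diff r L14).killable = true) ∧
    (∀ r ∈ rays, (Letter.diff r L15).n = 3 ∧ (Letter.diff r L15).killable = false) := by
  unfold rays L14 L15 R1 Rm Ri Rj
  decide

/-- Gram table of the five killable classes of one factor: theta meets every fibre class in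
`Θ·ℓ = 2 > 0` points and two distinct fibre classes meet in `2` or `4` points, so every stratum
with ≤ 2 killed steps of distinct classes per factor is non-empty; `Θ² = 2`, `ℓ² = 0`. -/
theorem gram_table :
    (Letter.diff L14 L15).dot (Letter.diff L14 L15) = 2 ∧
    (∀ r ∈ rays, (Letter.diff L14 L15).dot (Letter.diff r L14) = 2) ∧
    (∀ r ∈ rays, (Letter.diff r L14).dot (Letter.diff r L14) = 0) ∧
    (∀ r ∈ rays, ∀ r' ∈ rays, r ≠ r' →
      (Letter.diff r L14).dot (Letter.diff r' L14) = 2 ∨ (Letter.diff r L14).dot (Letter.diff r' L14) = 4) := by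
  unfold rays L14 L15 R1 Rm Ri Rj
  decide

/-! ## The A-isolation law (finite combinatorics of the live graph)

The six letters as a finite type; `live a b` is the class-level liveness table of record
(`b3cohom.hom_h0_factor`, aligned): identity, `R_ζ → 14I`, `14I → 15I`, `R_ζ → 15I`;
`killableStep a b` = live with killable class = `R_ζ → 14I` or `14I → 15I`. -/

/-- The letters of the 2-level alphabet as a finite type. -/
inductive L | l14 | l15 | r1 | rm | ri | rj
  deriving DecidableEq, Fintype, Repr

/-- The class of a symbol. -/
def L.cls : L → Letter
  | .l14 => L14 | .l15 => L15 | .r1 => R1 | .rm => Rm | .ri => Ri | .rj => Rj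

/-- Is the symbol a ray `R_ζ`? -/
def L.isRay : L → Bool
  | .l14 => false | .l15 => false | _ => true

/-- Class-level liveness of a factor step (table of record). -/
def live : L → L → Bool
  | a, b => decide (a = b) || (a.isRay && decide (b = L.l14)) || (decide (a = L.l14) && decide (b = L.l15))
            || (a.isRay && decide (b = L.l15))

/-- Killable live steps: `R_ζ → 14I` and `14I → 15I`. -/
def killableStep : L → L → Bool
  | a, b => (a.isRay && decide (b = L.l14)) || (decide (a = L.l14) && decide (b = L.l15))

/-- Consistency of the symbolic tables with the class arithmetic: a live step between distinct
symbols is `killableStep` iff its difference class is `killable`. -/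
theorem killableStep_iff_killable :
    ∀ a b : L, live a b = true → a ≠ b → killableStep a b = (Letter.diff a.cls b.cls).killable := by
  unfold L.cls L14 L15 R1 Rm Ri Rj
  decide

/-- The live NON-killable steps (identity and `R_ζ → 15I`) preserve the letter `14I`. -/
theorem live_nonkillable_preserves_14 :
    ∀ a b : L, live a b = true → killableStep a b = false → (a = L.l14 ↔ b = L.l14) := by
  decide

/-- From each symbol there is at most one killable step, and it is the theta step at `14I`, the
null step at a ray: so «theta at the `14I`-positions, the ray's fibre at the `R`-positions» is ONE
step per factor. -/
theorem killable_step_unique :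
    ∀ a b : L, killableStep a b = true → (a = L.l14 ∧ b = L.l15) ∨ (a.isRay = true ∧ b = L.l14) := by
  decide

/-- A cell of `X = S^4` over the alphabet. -/
abbrev Cell := Fin 4 → L

/-- Number of `14I`-letters of a cell. -/
def count14 (x : Cell) : ℕ := (Finset.univ.filter fun f => x f = L.l14).card

/-- A live arc `x → y` of the class-level graph: live in every factor. -/
def liveArc (x y : Cell) : Prop := ∀ f, live (x f) (y f) = true

/-- **A-isolation law (combinatorial core).**  If a live arc `x → y` uses no killable step in any
factor then `y` has the same number of `14I`-letters as `x`.  Contrapositive: every live target of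
`x` with a different `14I`-count (on `2f9bdad8`: every N-cell, N = even count, P = odd count) uses
in some factor THE killable step leaving `x_f`, hence dies at the product point killing those. -/
theorem targets_use_killable_step (x y : Cell) (h : liveArc x y)
    (hk : ∀ f, killableStep (x f) (y f) = false) : count14 y = count14 x := by
  unfold count14
  congr 1
  ext f
  simp only [Finset.mem_filter, Finset.mem_univ, true_and]
  exact ((live_nonkillable_preserves_14 (x f) (y f) (h f) (hk f))).symm

/-- The same law stated as isolation: if every live target `y ≠ x` among the N-cells has a
`14I`-count different from `x`, then every live arc from `x` into `Nset` uses a killable step. -/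
theorem isolation_of_count (x : Cell) (Nset : Set Cell)
    (hN : ∀ y ∈ Nset, count14 y ≠ count14 x) :
    ∀ y ∈ Nset, liveArc x y → ∃ f, killableStep (x f) (y f) = true := by
  intro y hy hl
  by_contra hne
  have hk : ∀ f, killableStep (x f) (y f) = false :=
    fun f => Bool.eq_false_iff.mpr (fun hf => hne ⟨f, hf⟩)
  exact hN y hy (targets_use_killable_step x y hl hk)

/-- Parity instance used on `2f9bdad8`: an odd count is never an even count. -/
theorem odd_ne_even (m k : ℕ) (hm : Odd m) (hk : Even k) : k ≠ m := by
  rintro rfl; exact (Nat.not_even_iff_odd.mpr hm) hk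

/-- The generic C-Hall failure that finishes the kill of `2f9bdad8` once `A = 0`: the C-copies of a
cell `(14I, R, R, R)` number `56`, its live sources are the four N-cells `(R_ζ, R, R, R)` whose
multiplicities on the design are at most `11` each (the cell of record has `28` in total). -/
theorem cHall_2f9bdad8 : ¬ (56 : ℕ) ≤ 4 * 11 ∧ ¬ (56 : ℕ) ≤ 28 := by decide

/-! ## The Chern-slack law: co-atom row in the truncated factor ring

`T = ℤ⟨1, A, pt⟩` with `A² = 2pt`, `A·pt = pt² = 0` is the even cohomology of one factor
restricted to `span{1, Θ, pt}`; an element is a triple `(c₀, c₁, c₂) = c₀ + c₁A + c₂pt`. -/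

/-- Multiplication in `T = ℤ[A,pt]/(A² − 2pt, A·pt, pt²)`. -/
def tmul (u v : ℤ × ℤ × ℤ) : ℤ × ℤ × ℤ :=
  (u.1 * v.1, u.1 * v.2.1 + u.2.1 * v.1, u.1 * v.2.2 + u.2.2 * v.1 + 2 * u.2.1 * v.2.1)

/-- `tmul` is associative. -/
theorem tmul_assoc (u v w : ℤ × ℤ × ℤ) : tmul (tmul u v) w = tmul u (tmul v w) := by
  unfold tmul; ext <;> simp only <;> ring

/-- `tmul` is commutative. -/
theorem tmul_comm (u v : ℤ × ℤ × ℤ) : tmul u v = tmul v u := by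
  unfold tmul; ext <;> simp only <;> ring

/-- Powers in `T`. -/
def tpow (u : ℤ × ℤ × ℤ) : ℕ → ℤ × ℤ × ℤ
  | 0 => (1, 0, 0)
  | k + 1 => tmul u (tpow u k)

/-- `c(O(−Θ)) = 1 − A`. -/
def oneMinusA : ℤ × ℤ × ℤ := (1, -1, 0)

/-- The claimed inverse power `(1 − A)^{−a} = 1 + aA + a(a+1)pt`. -/
def invPow (a : ℤ) : ℤ × ℤ × ℤ := (1, a, a * (a + 1))

/-- One step: `(1 − A)·(1 + (a+1)A + (a+1)(a+2)pt) = 1 + aA + a(a+1)pt`. -/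
theorem coatom_step (a : ℤ) : tmul oneMinusA (invPow (a + 1)) = invPow a := by
  unfold tmul oneMinusA invPow; ext <;> simp only <;> ring

/-- **Co-atom factor identity.**  `(1 − A)^a · (1 + aA + a(a+1)pt) = 1` in `T` for every `a : ℕ`,
i.e. `c(−a·[O(−Θ)]) = (1 − A)^{−a} = 1 + aA + a(a+1)pt`: the total Chern class of the virtual
bundle `a·O − a·O(−Θ)` on one factor has a degree-2 term `a(a+1)pt ≠ 0` as soon as `a ≥ 1`. -/
theorem coatom_factor_identity (a : ℕ) : tmul (tpow oneMinusA a) (invPow a) = (1, 0, 0) := by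
  induction a with
  | zero => unfold tpow invPow tmul; simp
  | succ k ih =>
    calc tmul (tpow oneMinusA (k + 1)) (invPow ((k : ℤ) + 1))
        = tmul (tpow oneMinusA k) (tmul oneMinusA (invPow ((k : ℤ) + 1))) := by
          rw [show tpow oneMinusA (k + 1) = tmul oneMinusA (tpow oneMinusA k) from rfl,
            tmul_comm oneMinusA, tmul_assoc]
      _ = tmul (tpow oneMinusA k) (invPow k) := by rw [coatom_step]
      _ = (1, 0, 0) := ih

/-- The degree-2 coefficient `a(a+1)` is positive for `a ≥ 1` (so the factor polynomial has
degree exactly 2 and `c(V)` has top degree `2·#{p : a_p ≥ 1}`). -/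
theorem invPow_deg2_pos (a : ℤ) (ha : 1 ≤ a) : 0 < a * (a + 1) := by positivity

/-- `c₃(V)·H⁵` for the co-atom block as a function of `a = (a₁..a₄)`:
`960·e₃(a) + 240·Σ_{p≠q} a_p(a_p+1)·a_q` (`∫ A_pA_qA_r·H⁵ = 960`, `∫ pt_p A_q·H⁵ = 240`). -/
def c3H5 (a₁ a₂ a₃ a₄ : ℤ) : ℤ :=
  960 * (a₁*a₂*a₃ + a₁*a₂*a₄ + a₁*a₃*a₄ + a₂*a₃*a₄)
  + 240 * (a₁*(a₁+1)*(a₂+a₃+a₄) + a₂*(a₂+1)*(a₁+a₃+a₄) + a₃*(a₃+1)*(a₁+a₂+a₄) + a₄*(a₄+1)*(a₁+a₂+a₃))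

/-- `c₃·H⁵ > 0` whenever all `a_p ≥ 1` (so `c₃(V) ≠ 0`). -/
theorem c3H5_pos (a₁ a₂ a₃ a₄ : ℤ) (h₁ : 1 ≤ a₁) (h₂ : 1 ≤ a₂) (h₃ : 1 ≤ a₃) (h₄ : 1 ≤ a₄) :
    0 < c3H5 a₁ a₂ a₃ a₄ := by
  unfold c3H5; positivity

/-- **Co-atom violation on the oriented design of record `1d7e39cf`.**  `m_N(15I⁴) = 1914`,
`a_p = 478` for the four cells `14I_p·15I³`: slack `s = 2 < 3` while `c₃(V)·H⁵ = 734 585 199 360`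
(the value printed by `cslaw.py`), so `c₃(V) ≠ 0` and LAW CS fails: no display on `1d7e39cf`
has `i` a sub-bundle — independently of the theta-strata kill and of the labelling. -/
theorem coatom_violation_1d7e39cf :
    (1914 : ℤ) - 4 * 478 = 2 ∧ c3H5 478 478 478 478 = 734585199360 ∧ (2 : ℤ) < 3 := by
  unfold c3H5; norm_num

/-- The exact co-atom CS row of the alphabet (integer form): `m_N(15I⁴) − Σ_p a_p ≥ 2·#{p : a_p ≥ 1}`;
on `1d7e39cf` the right side is `8` and the left side `2`. -/
theorem coatom_row_1d7e39cf : ¬ ((2 : ℤ) * 4 ≤ 1914 - 4 * 478) := by norm_num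

/-- The second violated closure row found by `cslaw.py` on `1d7e39cf`, `U = {15I⁴} ∪ {14I²15I²}`:
`m(U) = 1914 + 6·7168 = 44922`, `a(A_{⊆U}) = 4·478 + 4·10752 = 44920`, slack `2`; after the twist
by `O(−15h)` one has `c(V) = ∏_p (1 − A_p)^{E_p}` with `E_p = 3·7168 − 478 − 3·10752 = −11230 ≠ 0, −1`
per factor, so every factor polynomial has degree 2 and `c_j(V) ≠ 0` up to `j = 8 > 2`. -/
theorem closure_row2_1d7e39cf :
    (1914 : ℤ) + 6 * 7168 = 44922 ∧ (4 : ℤ) * 478 + 4 * 10752 = 44920 ∧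
    (3 : ℤ) * 7168 - 478 - 3 * 10752 = -11230 := by norm_num

end Summit.HodgeConjecture.HodgeConjecture.Cruxes.BlochSeedDiscOne.ThetaKill
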